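import Summits.BirchSwinnertonDyer.BirchSwinnertonDyer.Theorems.EdixhovenFibreFiveSevenCiteConeClosersOfHasDualExp
import Literature.NumberTheory.PAdicHodge.TateH1BdRFilOfTS1
import HarnessLib

/-!
# Route `EdixhovenFibreFiveSeven` — the Manin cruxes' cite-cone closers RE-KEYED on Tate's (TS1)
# (TDS57 22227, KP57 23810, TDS11 22228, CORNER 23883, LOW 23884; and AKR #7 20709)

Cell `pub/bsd-wall`, seat `bsd-line-edix-p4` g6 (line `kato-lever`, b7-top). TOOL theorems only (no definition, no named fact,
no `sorry`). The closers `KatoSl2NeronClosersOfHasDualExp.*_of_hasDualExp` (seat edix-p2 g8) display the cite-only fact hP′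
`hasDualExp_of_isDeRham` (Kato LNM 1553 II Prop. 1.2.3, surjectivity half, every de Rham `V`). That fact is now a tree THEOREM
modulo Tate's (TS1) `tate1967_TS1_completedAlgClosure` (Tate 1967 §3.2 Prop. 9 / Berger–Colmez (TS1)):
`PAdicHodge.BdRH1Devissage.hasDualExp_of_isDeRham_of_TS1` (file `TateH1BdRFilOfTS1`: filtered comparison for de Rham `V` +
Kato's `t`-adic dévissage of `H¹(K, B^m_dR)` + continuity of the `Γ_F`-action on `B_dR⁺` for Fontaine's topology, all proved).
So every closer is re-keyed here on the binder set {P1 `exists_member_sl2ZetaElement_neron_values`, (S5b-tower)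
`exists_smul_range_expStarCoord_tower_iff_trace_log`, (TS1), hDR `isDeRham_restrictedRationalTateRep`}
[+ modularity `exists_isNewformOf` for KP57 / CORNER / LOW]. Items stay OPEN (conditional results); nothing cite-only is
discharged here; BSD is not proved by any of this.
-/

set_option autoImplicit false
-- the Theorems namespace of a single-conjunct summit repeats the summit name by design (D-0017)
set_option linter.dupNamespace false

noncomputable section

open Literature.NumberTheory.PAdicHodge
open Literature.NumberTheory.EllipticCurves Literature.NumberTheory.EllipticCurves.ModularForms
open Literature.NumberTheory.EllipticCurves.Kato2004
open Summit.BirchSwinnertonDyer.BirchSwinnertonDyer.Theses.EdixhovenFibreFiveSeven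

namespace Summit.BirchSwinnertonDyer.BirchSwinnertonDyer.Theorems.KatoSl2NeronClosersOfTS1

/-- **TDS57 `TwistDegreeStepFiveSeven` (stmt-BirchSwinnertonDyer-22227) GRANTED P1, (S5b-tower), (TS1) and de Rham** —
`KatoSl2NeronClosersOfHasDualExp.twistDegreeStepFiveSeven_of_hasDualExp` with hP′ fed by the theorem
`BdRH1Devissage.hasDualExp_of_isDeRham_of_TS1`. CONDITIONAL; the item is not closed by this.
[cite: Kato2004Asterisque, (8.1.3) (p. 180), Thm. 9.7 (p. 189)] [cite: Kato1993LNM1553, Ch. II Prop. 1.2.3, §1.2.7 and Thm. 1.4.1 (3)-(4)] [cite: Tate1967, §3.2 Prop. 9] -/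
theorem twistDegreeStepFiveSeven_of_TS1
    (hT₂ : exists_smul_range_expStarCoord_tower_iff_trace_log) (hTS1 : tate1967_TS1_completedAlgClosure)
    (hDR : isDeRham_restrictedRationalTateRep) (hP1 : exists_member_sl2ZetaElement_neron_values) :
    TwistDegreeStepFiveSeven :=
  KatoSl2NeronClosersOfHasDualExp.twistDegreeStepFiveSeven_of_hasDualExp hT₂
    (BdRH1Devissage.hasDualExp_of_isDeRham_of_TS1 hTS1) hDR hP1

/-- **KP57 `KPResidueManinUnitFiveSeven` (stmt-BirchSwinnertonDyer-23810) GRANTED modularity, P1, (S5b-tower), (TS1) and de Rham.**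
CONDITIONAL; the item is not closed by this.
[cite: KostersPannekoek2017, Thm. 1 and Cor. 2] [cite: Kato2004Asterisque, (8.1.3) (p. 180), Thm. 9.7 (p. 189)] [cite: Tate1967, §3.2 Prop. 9] -/
theorem kpResidueManinUnitFiveSeven_of_TS1 (hnf : exists_isNewformOf)
    (hT₂ : exists_smul_range_expStarCoord_tower_iff_trace_log) (hTS1 : tate1967_TS1_completedAlgClosure)
    (hDR : isDeRham_restrictedRationalTateRep) (hP1 : exists_member_sl2ZetaElement_neron_values) :
    KPResidueManinUnitFiveSeven :=
  KatoSl2NeronClosersOfHasDualExp.kpResidueManinUnitFiveSeven_of_hasDualExp hnf hT₂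
    (BdRH1Devissage.hasDualExp_of_isDeRham_of_TS1 hTS1) hDR hP1

/-- **TDS11 `TwistDegreeStepOrdinary` (stmt-BirchSwinnertonDyer-22228) GRANTED P1, (S5b-tower), (TS1) and de Rham.**
CONDITIONAL; the item is not closed by this.
[cite: Kato2004Asterisque, (8.1.3) (p. 180), Thm. 9.7 (p. 189)] [cite: EdixhovenManin1991, §4] [cite: Tate1967, §3.2 Prop. 9] -/
theorem twistDegreeStepOrdinary_of_TS1
    (hT₂ : exists_smul_range_expStarCoord_tower_iff_trace_log) (hTS1 : tate1967_TS1_completedAlgClosure)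
    (hDR : isDeRham_restrictedRationalTateRep) (hP1 : exists_member_sl2ZetaElement_neron_values) :
    TwistDegreeStepOrdinary :=
  KatoSl2NeronClosersOfHasDualExp.twistDegreeStepOrdinary_of_hasDualExp hT₂
    (BdRH1Devissage.hasDualExp_of_isDeRham_of_TS1 hTS1) hDR hP1

/-- **CORNER `KummerCornerTorsionOptimalManinUnit` (stmt-BirchSwinnertonDyer-23883) GRANTED modularity, P1, (S5b-tower), (TS1)
and de Rham.** CONDITIONAL; the item is not closed by this.
[cite: KostersPannekoek2017, Cor. 2] [cite: Kato2004Asterisque, Thm. 9.7 (p. 189)] [cite: Tate1967, §3.2 Prop. 9] -/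
theorem kummerCornerTorsionOptimalManinUnit_of_TS1 (hnf : exists_isNewformOf)
    (hT₂ : exists_smul_range_expStarCoord_tower_iff_trace_log) (hTS1 : tate1967_TS1_completedAlgClosure)
    (hDR : isDeRham_restrictedRationalTateRep) (hP1 : exists_member_sl2ZetaElement_neron_values) :
    KummerCornerTorsionOptimalManinUnit :=
  KatoSl2NeronClosersOfHasDualExp.kummerCornerTorsionOptimalManinUnit_of_hasDualExp hnf hT₂
    (BdRH1Devissage.hasDualExp_of_isDeRham_of_TS1 hTS1) hDR hP1

/-- **LOW `SupersingularTorsionOptimalManinUnitFive` (stmt-BirchSwinnertonDyer-23884) GRANTED modularity, P1, (S5b-tower), (TS1)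
and de Rham.** CONDITIONAL; the item is not closed by this.
[cite: KostersPannekoek2017, Cor. 2] [cite: Kato2004Asterisque, Thm. 9.7 (p. 189)] [cite: Tate1967, §3.2 Prop. 9] -/
theorem supersingularTorsionOptimalManinUnitFive_of_TS1 (hnf : exists_isNewformOf)
    (hT₂ : exists_smul_range_expStarCoord_tower_iff_trace_log) (hTS1 : tate1967_TS1_completedAlgClosure)
    (hDR : isDeRham_restrictedRationalTateRep) (hP1 : exists_member_sl2ZetaElement_neron_values) :
    SupersingularTorsionOptimalManinUnitFive :=
  KatoSl2NeronClosersOfHasDualExp.supersingularTorsionOptimalManinUnitFive_of_hasDualExp hnf hT₂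
    (BdRH1Devissage.hasDualExp_of_isDeRham_of_TS1 hTS1) hDR hP1

/-- **AKR crux #7 `ManinFrameResidueProperR` (stmt-BirchSwinnertonDyer-20709, route `AdditiveKolyvaginRoad`) GRANTED P1,
(S5b-tower), (TS1) and de Rham.** CONDITIONAL; the item is not closed by this.
[cite: Kato2004Asterisque, (8.1.3) (p. 180), Thm. 9.7 (p. 189), Thm. 13.6 (p. 227)] [cite: Kato1993LNM1553, Ch. II Prop. 1.2.3 and §1.2.7] [cite: Tate1967, §3.2 Prop. 9] -/
theorem maninFrameResidueProperR_of_TS1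
    (hT₂ : exists_smul_range_expStarCoord_tower_iff_trace_log) (hTS1 : tate1967_TS1_completedAlgClosure)
    (hDR : isDeRham_restrictedRationalTateRep) (hP1 : exists_member_sl2ZetaElement_neron_values) :
    Summit.BirchSwinnertonDyer.BirchSwinnertonDyer.Theses.AdditiveKolyvaginRoad.ManinFrameResidueProperR :=
  KatoSl2NeronClosersOfHasDualExp.maninFrameResidueProperR_of_hasDualExp hT₂
    (BdRH1Devissage.hasDualExp_of_isDeRham_of_TS1 hTS1) hDR hP1

end Summit.BirchSwinnertonDyer.BirchSwinnertonDyer.Theorems.KatoSl2NeronClosersOfTS1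

end
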